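import Summits.QuantumFields.YangMills.Theorems.BalabanUVNodesN15VectorPiecePlain
import Summits.QuantumFields.YangMills.Theorems.BalabanUVNodesN15VectorPieceBackgroundMatrix
import Summits.QuantumFields.YangMills.Theorems.BalabanUVNodesN15BackgroundV1ByName
import HarnessLib

/-!
# Route «BalabanUVNodes» (K4 «SpineRates»), node N15 = NE2 — THE BACKWARD UNIT SHIFT `S_{−ν}` ON FINE 1-FORMS AND ITS TWO-SPACING DEFECT THROUGH
# KING's FLOOR PAIRING: one lattice step under a coordinatewise floor map, the block ∕ pairing dichotomies, and the block-majorant transfer lemmas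

Cell `pub-ymgap`, seat `pub-ymgap-dag-n15-c` (generation g3; R134 ACCELERATION SEAT, strategy s1 «first missing estimate»; HUMAN RULING D-0062; chair R424
venue; `bears_on: R4∕N15`).  Filed `--supports stmt-QuantumFields-19908 --as helper` (K3′ «SpineGivenEndpointR12»; helper).  Imports BY NAME, nothing in the
tree modified: n15-a part 26 `…N15VectorPiecePlain` (through it parts 15∕21: `blkFine`, `kingPr`∕`kingPrV`∕`kingPr_val`, `blkFine_comp_kingPrV`; the [B6]
carrier `B6UnitTorusCarrier.unitTorusGeo`; `B11AxialTransport190.loc_ofBlocks_le`∕`abs_le_loc_ofBlocks`), `King1986.Torus` (`blockOf`, `val_blockOf`, `tdistT`,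
`tdistT_sub_unitVec_le`; cf. n15-b's `…N15KingTorusLine.kingLine` for the forward step); for the §4 data: this seat's M4 `…N15VectorPieceBackgroundMatrix`
(`tensorId`; n15-a's `pieceG`∕`pieceD1`∕`pieceS`∕`pieceD3`, `unitTorusGeoS`, `thetaV`, `VecIndexS`) and g0's `…N15VectorPieceBackgroundFirstOrder` (`pieceM`), and
this seat's V1b∕V2 `…N15BackgroundV1Species`∕`…N15BackgroundV1ByName` (`v1Instance`, `v1Family4`).

WHY (this seat's g2 HANDOFF «LOCATED (V3)»; the print's `V′₁(A)` of [B9] (3.52) carries BOTH bond orientations: `V′₁ = M_c + Σ_μ[M_{a⁺_μ}∇⁺_μ + M_{a⁻_μ}∇⁻_μ]`,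
so the stacked propagator of (3.65) runs over the forward AND backward derived pieces `∇^±_μG`; `…N15BackgroundV1ByName.ne2PlusOperator_v1` (p468524) displays
their `U ≡ 1` letters as hypotheses).  The backward derivative is the forward one read one step back: `∇⁻_ν = S_{−ν}∇⁺_ν`, `(S_{−ν}f)(x) = f(x − e_ν)`.  Its
η-defect through King's pairing `π = ⌊·∕L^m⌋` is NOT the shifted forward defect alone — the floor pairing is not shift-covariant:
`𝔇(S′_{−ν}T′, S_{−ν}T) = S′_{−ν}·𝔇(T′, T) + 𝔇(S′_{−ν}, S_{−ν})·T`, and `𝔇(S′_{−ν}, S_{−ν})g (x′) = g(π(x′ − e′_ν)) − g(πx′ − e_ν)` is `0` on the lower `ν`-face of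
the block (`π(x′ − e′_ν) = πx′ − e_ν`) and the ONE-STEP DIFFERENCE `g(πx′) − g(πx′ − e_ν)` inside it (`π(x′ − e′_ν) = πx′`).  THIS FILE supplies the
lattice-geometric half of that analysis: the dichotomy (one lemma for every coordinatewise floor map, instantiated at King's unit blocks `blockOf` and at King's
pairing `kingPr`), and three block-majorant transfer lemmas — a self-map of the target lattice moving blocks by at most one unit step costs a factor `e^{ρ}`
(`hasMaj_bshiftV_comp`), and the defect `𝔇(S′, S)·T` is majorised by any majorant of `(1 − S)·T` (`hasMaj_idefShift_comp`).  The analytic half (the one-step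
difference of `∂_νH_k` is Hölder-small with decay: b05 `B5Hk163TorusHolderDecay`) is `…N15DefectKernelBDHk163`; the pieces are `…N15VectorPieceBackward`.

CONTENTS.
* §1 `floorMap_add_unitVec` (one lattice step under `⌊·∕R⌋` on residues: `+e_κ` on the image iff `R ∣ z_κ + 1`), `blockOf_add_unitVec`, `blockOf_sub_unitVec`
  (dichotomy), `tdistT_blockOf_sub_unitVec_le` (`|B(x − e_κ) − B(x)|_T ≤ 1`), `kingPr_add_unitVec`, `kingPr_sub_unitVec` (dichotomy), `kingPrV_sub`.
* §2 `bshiftV` (`S_{−κ}` on fine 1-forms: base point back one step, same bond direction), `bshiftV_apply`, `sub_bshiftV_apply`, `bshiftV_comp_single`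
  (entries of `S_{−κ}∘A`), `idef_bshiftV_apply` (the defect of the two shifts through King's bond pairing, pointwise).
* §3 `hasMaj_pull_comp` (generic: a pull-back along a target self-map, kernel transferred along the block displacement), **`hasMaj_bshiftV_comp`**
  (`K = B·e^{−ρ|y−y′|_T}` ↦ `B·e^{ρ}·e^{−ρ|y−y′|_T}`), **`hasMaj_idefShift_comp`** (`𝔇(S′_{−κ}, S_{−κ})∘T` through King's pairing ≤ any majorant of `(1 − S_{−κ})∘T`),
  `idef_bshiftV_comp` (Leibniz: `𝔇(S′T′, ST) = S′∘𝔇(T′,T) + 𝔇(S′,S)∘T`).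
* §4 DATA ONLY (no `Prop`-valued defs): the BACKWARD pieces `pieceD1b` (`∇⁻_νG = S_{−ν}(∂_νG)`), `pieceMb` (`∇⁻_μG∇_ν* = S_{−μ}(∂_μG∂_ν*)`), the derived ∕ mixed
  pieces indexed by the forward∕backward stack `dPieces`, `mPieces` (`Sum.elim`; `_inl`∕`_inr`), and the REALISED `V′₁` INSTANCE FAMILY at the vector piece ⊗ 1_𝔤:
  `v1VecInstance` (V1b's `v1Instance` over the sized unit-torus carrier), `v1VecFamily4` (V2's `v1Family4` fed with the lifted pieces, `ν_j = inl j.ν`),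
  `v1VecInstance_gf_M` (guard LIVE, `rfl`), `reg335_v1Vec_iff` (what (3.35) says here, `Iff.rfl`).  Their estimates are `…N15VectorPieceBackward` ∕ `…N15VectorPieceV1`.

HONEST FRAMING ∕ LIMITS.  [folklore] lattice bookkeeping on finite tori (`Π ℤ∕(nM_μ)` over `Π ℤ∕M_μ`): no operator of the print is estimated here.  `U = 1`
linear theory vocabulary only; NE2⁺ proper NOT PRINTED ∕ not proved; count-neutral (typed 28∕28 · discharged unchanged); NOT a discharge of N15; one finite
T⁴ at fixed ε — NOT infinite volume, NOT OS on ℝ⁴, NOT a mass gap, NOT Clay.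
-/

noncomputable section

open scoped BigOperators
open Finset

namespace Summit.QuantumFields.YangMills.BalabanUVNodes.N15.VectorPiece

open Literature.MathematicalPhysics.QuantumFieldTheory.Balaban1983to89
open Literature.MathematicalPhysics.QuantumFieldTheory.Balaban1983to89.B11SectG (BlockNorm HasMaj)
open Literature.MathematicalPhysics.QuantumFieldTheory.Balaban1983to89.T4EtaRateDefect (idef idef_apply idef_comp)
open Literature.MathematicalPhysics.QuantumFieldTheory.Balaban1983to89.T4EtaRateCoeffDefect (pull pull_apply)
open Literature.MathematicalPhysics.QuantumFieldTheory.Balaban1983to89.B11AxialTransport190 (abs_le_loc_ofBlocks loc_ofBlocks_le)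
open Literature.MathematicalPhysics.QuantumFieldTheory.Balaban1983to89.B5Prop11Plancherel (Tor fine unitVec)
open Literature.MathematicalPhysics.QuantumFieldTheory.Balaban1983to89.B6UnitTorusCarrier (unitTorusGeo unitTorusGeo_dist)
open Literature.MathematicalPhysics.QuantumFieldTheory.King1986.Torus (blockOf val_blockOf tdistT tdistT_nonneg tdistT_symm tdistT_self tdistT_triangle
  tdistT_sub_unitVec_le)
open Literature.MathematicalPhysics.QuantumFieldTheory.Balaban1983to89.T4EtaRate (PairedInstance)
open Summit.QuantumFields.YangMills.BalabanUVNodes.N15.BackgroundLayer (v1Instance v1Family4)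

variable {d : ℕ}

/-! ## §1 One lattice step under a coordinatewise floor map; the block and pairing dichotomies -/

section Floor

variable {A B : Fin (d + 1) → ℕ} [∀ μ, NeZero (A μ)] [∀ μ, NeZero (B μ)]

/-- **ONE LATTICE STEP UNDER A COORDINATEWISE FLOOR MAP.**  If `φ : Π ℤ∕A_μ → Π ℤ∕B_μ` reads `⌊·∕R⌋` on residues (`(φx)_μ = ⌊x_μ∕R⌋`, `A_μ = R·B_μ`), then
`φ(z + e_κ) = φz + e_κ` when the step crosses a block face (`R ∣ z_κ + 1`; the wrap-around `A_κ ≡ 0` is invisible modulo `B_κ`) and `φ(z + e_κ) = φz`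
otherwise. [cite: King1986, p.664 (pairing convention «x′ ∈ B^n(x)», blocks as floors)] -/
theorem floorMap_add_unitVec {R : ℕ} (φ : Tor A → Tor B) (hφ : ∀ x μ, (φ x μ).val = (x μ).val / R) (hAB : ∀ μ, A μ = R * B μ)
    (z : Tor A) (κ : Fin (d + 1)) :
    φ (z + unitVec A κ) = if R ∣ (z κ).val + 1 then φ z + unitVec B κ else φ z := by
  -- coordinates off the direction `κ` are untouched
  have hoff : ∀ μ, μ ≠ κ → φ (z + unitVec A κ) μ = φ z μ := fun μ hμ => by
    apply ZMod.val_injective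
    rw [hφ, hφ, show (z + unitVec A κ) μ = z μ by simp [unitVec, hμ]]
  -- the stepped coordinate reads `⌊(z_κ + 1)∕R⌋`
  have hφz : φ z κ = (((z κ).val / R : ℕ) : ZMod (B κ)) := by rw [← hφ, ZMod.natCast_zmod_val]
  have hon : φ (z + unitVec A κ) κ =
      if R ∣ (z κ).val + 1 then (((z κ).val / R : ℕ) : ZMod (B κ)) + 1 else (((z κ).val / R : ℕ) : ZMod (B κ)) := by
    have hval : ((z + unitVec A κ) κ).val = ((z κ).val + 1) % A κ := by
      rw [show (z + unitVec A κ) κ = z κ + 1 by simp [unitVec], ZMod.val_add, ZMod.val_one_eq_one_mod, Nat.add_mod_mod]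
    have hmod : ((z κ).val + 1) % A κ / R = ((z κ).val + 1) / R % B κ := by
      rw [congrArg (fun t => ((z κ).val + 1) % t / R) (hAB κ)]
      exact Nat.mod_mul_right_div_self _ _ _
    calc φ (z + unitVec A κ) κ = (((φ (z + unitVec A κ) κ).val : ℕ) : ZMod (B κ)) := (ZMod.natCast_zmod_val _).symm
      _ = ((((z κ).val + 1) / R % B κ : ℕ) : ZMod (B κ)) := by rw [hφ, hval, hmod]
      _ = ((((z κ).val + 1) / R : ℕ) : ZMod (B κ)) := ZMod.natCast_mod _ _
      _ = _ := by
        rw [Nat.succ_div]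
        split_ifs <;> push_cast <;> ring
  funext μ
  by_cases hμ : μ = κ
  · subst hμ
    split_ifs with hdvd
    · rw [Pi.add_apply, hon, if_pos hdvd, hφz]
      simp [unitVec]
    · rw [hon, if_neg hdvd, hφz]
  · split_ifs with hdvd
    · rw [Pi.add_apply, hoff μ hμ, show unitVec B κ μ = 0 by simp [unitVec, hμ], add_zero]
    · exact hoff μ hμ

variable (n : ℕ) [NeZero n] (M : Fin (d + 1) → ℕ) [∀ μ, NeZero (M μ)]

/-- KING's UNIT BLOCK OF A STEPPED FINE POINT: `B(z + e_κ) = B(z) + e_κ` across a face (`n ∣ z_κ + 1`), `= B(z)` inside the block.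
[cite: King1986, p.664 (blocks B^k(x))] -/
theorem blockOf_add_unitVec (z : Tor (fine n M)) (κ : Fin (d + 1)) :
    blockOf n M (z + unitVec (fine n M) κ) = if n ∣ (z κ).val + 1 then blockOf n M z + unitVec M κ else blockOf n M z :=
  floorMap_add_unitVec (blockOf n M) (fun x μ => val_blockOf x μ) (fun _ => rfl) z κ

/-- **THE BLOCK DICHOTOMY ONE STEP BACK**: `B(x − e_κ)` is `B(x)` or `B(x) − e_κ`. [cite: King1986, p.664 (blocks B^k(x))] -/
theorem blockOf_sub_unitVec (x : Tor (fine n M)) (κ : Fin (d + 1)) :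
    blockOf n M (x - unitVec (fine n M) κ) = blockOf n M x ∨ blockOf n M (x - unitVec (fine n M) κ) = blockOf n M x - unitVec M κ := by
  have h := blockOf_add_unitVec n M (x - unitVec (fine n M) κ) κ
  rw [sub_add_cancel] at h
  by_cases hdvd : n ∣ ((x - unitVec (fine n M) κ) κ).val + 1
  · rw [if_pos hdvd] at h
    exact Or.inr (eq_sub_of_add_eq h.symm)
  · rw [if_neg hdvd] at h
    exact Or.inl h.symm

/-- `|B(x − e_κ) − B(x)|_T ≤ 1`: the block of the stepped-back point is the same block or its neighbour. [folklore] -/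
theorem tdistT_blockOf_sub_unitVec_le (x : Tor (fine n M)) (κ : Fin (d + 1)) :
    tdistT M (blockOf n M (x - unitVec (fine n M) κ)) (blockOf n M x) ≤ 1 := by
  rcases blockOf_sub_unitVec n M x κ with h | h
  · rw [h, tdistT_self]; exact zero_le_one
  · rw [h, tdistT_symm]; exact tdistT_sub_unitVec_le M _ κ

variable (L k m : ℕ) [NeZero L]

/-- KING's PAIRING OF A STEPPED FINE POINT (`(pr x′)_μ = ⌊x′_μ∕L^m⌋` between the `η′ = L^{−m}η` and `η` lattices): `pr(z + e′_κ) = pr z + e_κ` when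
`L^m ∣ z_κ + 1`, `= pr z` otherwise. [cite: King1986, p.664 (pairing convention «x′ ∈ B^n(x)»)] -/
theorem kingPr_add_unitVec (z : Tor (fine (L ^ m * L ^ k) M)) (κ : Fin (d + 1)) :
    kingPr L k m M (z + unitVec (fine (L ^ m * L ^ k) M) κ) =
      if L ^ m ∣ (z κ).val + 1 then kingPr L k m M z + unitVec (fine (L ^ k) M) κ else kingPr L k m M z :=
  floorMap_add_unitVec (kingPr L k m M) (fun x μ => kingPr_val L k m M x μ) (fun _ => Nat.mul_assoc _ _ _) z κ

/-- **THE PAIRING DICHOTOMY ONE STEP BACK**: `pr(x′ − e′_κ)` is `pr x′` (inside the block) or `pr x′ − e_κ` (on its lower `κ`-face). [cite: King1986, p.664 (pairing convention)] -/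
theorem kingPr_sub_unitVec (x' : Tor (fine (L ^ m * L ^ k) M)) (κ : Fin (d + 1)) :
    kingPr L k m M (x' - unitVec (fine (L ^ m * L ^ k) M) κ) = kingPr L k m M x' ∨
      kingPr L k m M (x' - unitVec (fine (L ^ m * L ^ k) M) κ) = kingPr L k m M x' - unitVec (fine (L ^ k) M) κ := by
  have h := kingPr_add_unitVec M L k m (x' - unitVec (fine (L ^ m * L ^ k) M) κ) κ
  rw [sub_add_cancel] at h
  by_cases hdvd : L ^ m ∣ ((x' - unitVec (fine (L ^ m * L ^ k) M) κ) κ).val + 1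
  · rw [if_pos hdvd] at h
    exact Or.inr (eq_sub_of_add_eq h.symm)
  · rw [if_neg hdvd] at h
    exact Or.inl h.symm

/-- The bond pairing one step back: `prV(x′ − e′_κ, a)` is `prV(x′, a)` or `(pr x′ − e_κ, a)`. [folklore] -/
theorem kingPrV_sub (i : Tor (fine (L ^ m * L ^ k) M) × Fin (d + 1)) (κ : Fin (d + 1)) :
    kingPrV L k m M (i.1 - unitVec (fine (L ^ m * L ^ k) M) κ, i.2) = kingPrV L k m M i ∨
      kingPrV L k m M (i.1 - unitVec (fine (L ^ m * L ^ k) M) κ, i.2) =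
        ((kingPrV L k m M i).1 - unitVec (fine (L ^ k) M) κ, (kingPrV L k m M i).2) := by
  rw [kingPrV_eq, kingPrV_eq]
  rcases kingPr_sub_unitVec M L k m i.1 κ with h | h
  · exact Or.inl (by rw [h])
  · exact Or.inr (by rw [h])

end Floor

/-! ## §2 The backward unit shift on fine 1-forms -/

section Shift

variable (M : Fin (d + 1) → ℕ) (n : ℕ)

/-- THE BACKWARD UNIT SHIFT `S_{−κ}` ON LEVEL-`n` FINE 1-FORMS: `(S_{−κ}f)(x, a) = f(x − e_κ, a)` (base point one lattice step back in direction `κ`, same bond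
direction) — so that the backward difference quotient is the forward one read one step back, `∇⁻_κ = S_{−κ}∇⁺_κ`. [cite: Balaban1984PropagatorsI, (1.21) p.21 (forward and backward difference quotients)] -/
def bshiftV (κ : Fin (d + 1)) : (Tor (fine n M) × Fin (d + 1) → ℝ) →ₗ[ℝ] (Tor (fine n M) × Fin (d + 1) → ℝ) :=
  pull fun i : Tor (fine n M) × Fin (d + 1) => (i.1 - unitVec (fine n M) κ, i.2)

/-- Pointwise form. [folklore] -/
@[simp] theorem bshiftV_apply (κ : Fin (d + 1)) (f : Tor (fine n M) × Fin (d + 1) → ℝ) (i : Tor (fine n M) × Fin (d + 1)) :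
    bshiftV M n κ f i = f (i.1 - unitVec (fine n M) κ, i.2) := rfl

/-- The one-step difference `(1 − S_{−κ})f (x, a) = f(x, a) − f(x − e_κ, a)` (`= η·(∇⁻_κ f)(x, a)`). [folklore] -/
theorem sub_bshiftV_apply (κ : Fin (d + 1)) (f : Tor (fine n M) × Fin (d + 1) → ℝ) (i : Tor (fine n M) × Fin (d + 1)) :
    (LinearMap.id - bshiftV M n κ : (Tor (fine n M) × Fin (d + 1) → ℝ) →ₗ[ℝ] (Tor (fine n M) × Fin (d + 1) → ℝ)) f i =
      f i - f (i.1 - unitVec (fine n M) κ, i.2) := rfl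

/-- ENTRIES OF A SHIFTED OPERATOR: `(S_{−κ}A)(δ_b)(x, a) = A(δ_b)(x − e_κ, a)`. [folklore] -/
theorem bshiftV_comp_single {Y : Type} (κ : Fin (d + 1)) (A : (Y → ℝ) →ₗ[ℝ] (Tor (fine n M) × Fin (d + 1) → ℝ)) (v : Y → ℝ)
    (i : Tor (fine n M) × Fin (d + 1)) : (bshiftV M n κ ∘ₗ A) v i = A v (i.1 - unitVec (fine n M) κ, i.2) := rfl

variable (L k m : ℕ)

/-- THE DEFECT OF THE TWO SHIFTS THROUGH KING's BOND PAIRING, pointwise: `𝔇(S′_{−κ}, S_{−κ})g (x′, a) = g(prV(x′ − e′_κ, a)) − g(pr x′ − e_κ, a)`. [folklore] -/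
theorem idef_bshiftV_apply (κ : Fin (d + 1)) (g : Tor (fine (L ^ k) M) × Fin (d + 1) → ℝ) (i : Tor (fine (L ^ m * L ^ k) M) × Fin (d + 1)) :
    idef (pull (kingPrV L k m M)) (pull (kingPrV L k m M)) (bshiftV M (L ^ m * L ^ k) κ) (bshiftV M (L ^ k) κ) g i =
      g (kingPrV L k m M (i.1 - unitVec (fine (L ^ m * L ^ k) M) κ, i.2)) -
        g ((kingPrV L k m M i).1 - unitVec (fine (L ^ k) M) κ, (kingPrV L k m M i).2) := rfl

/-- LEIBNIZ for a shifted pair: `𝔇(S′T′, ST) = S′∘𝔇(T′, T) + 𝔇(S′, S)∘T` (fine factors left of the defect, coarse factors right of it). [folklore] -/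
theorem idef_bshiftV_comp {F₁ : Type} [AddCommGroup F₁] [Module ℝ F₁] (κ : Fin (d + 1))
    (τ₁ : F₁ →ₗ[ℝ] F₁) (T' : F₁ →ₗ[ℝ] (Tor (fine (L ^ m * L ^ k) M) × Fin (d + 1) → ℝ)) (T : F₁ →ₗ[ℝ] (Tor (fine (L ^ k) M) × Fin (d + 1) → ℝ)) :
    idef τ₁ (pull (kingPrV L k m M)) (bshiftV M (L ^ m * L ^ k) κ ∘ₗ T') (bshiftV M (L ^ k) κ ∘ₗ T) =
      bshiftV M (L ^ m * L ^ k) κ ∘ₗ idef τ₁ (pull (kingPrV L k m M)) T' T +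
        idef (pull (kingPrV L k m M)) (pull (kingPrV L k m M)) (bshiftV M (L ^ m * L ^ k) κ) (bshiftV M (L ^ k) κ) ∘ₗ T :=
  idef_comp _ _ _ _ _ _ _

end Shift

/-! ## §3 Block-majorant transfer: pull-backs along target self-maps, the shift, the defect of the shifts -/

section Transfer

variable {g : B6.Geometry} {F₁ : Type} [AddCommGroup F₁] [Module ℝ F₁] {X₂ : Type} [Fintype X₂]

/-- **A PULL-BACK ALONG A SELF-MAP OF THE TARGET LATTICE TRANSFERS A BLOCK MAJORANT ALONG THE BLOCK DISPLACEMENT**: if `T` has the majorant `K` into the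
sharp block norm of `blk₂` and `K(blk₂(s x), y′) ≤ K′(blk₂ x, y′)` for every target point `x` (`K′ ≥ 0`), then `(f ↦ (Tf)∘s)` has the majorant `K′`. [folklore] -/
theorem hasMaj_pull_comp {b₁ : BlockNorm g F₁} (blk₂ : X₂ → g.Site) (s : X₂ → X₂) {T : F₁ →ₗ[ℝ] (X₂ → ℝ)} {K K' : g.Site → g.Site → ℝ}
    (hK' : ∀ y y', 0 ≤ K' y y') (hs : ∀ x y', K (blk₂ (s x)) y' ≤ K' (blk₂ x) y') (h : HasMaj b₁ (BlockNorm.ofBlocks g blk₂) T K) :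
    HasMaj b₁ (BlockNorm.ofBlocks g blk₂) (pull s ∘ₗ T) K' := by
  intro y' μ hμ y
  refine loc_ofBlocks_le blk₂ _ (mul_nonneg (hK' y y') (b₁.loc_nonneg y' μ)) fun x hx => ?_
  rw [LinearMap.comp_apply, pull_apply]
  calc |T μ (s x)| ≤ (BlockNorm.ofBlocks g blk₂).loc (blk₂ (s x)) (T μ) := abs_le_loc_ofBlocks blk₂ _ rfl
    _ ≤ K (blk₂ (s x)) y' * b₁.loc y' μ := h y' μ hμ _
    _ ≤ K' y y' * b₁.loc y' μ := by rw [← hx]; exact mul_le_mul_of_nonneg_right (hs x y') (b₁.loc_nonneg y' μ)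

variable {L : ℕ} (M : Fin (d + 1) → ℕ) [∀ μ, NeZero (M μ)] (k n : ℕ) [NeZero n]

/-- **THE BACKWARD SHIFT COSTS A FACTOR `e^{ρ}`.**  On the unit-torus carrier with the level-`n` fine bonds blocked by the unit block of their base point: if `T` has
the block majorant `B·e^{−ρ|y−y′|_T}` (`B, ρ ≥ 0`), then `S_{−κ}∘T` has `B·e^{ρ}·e^{−ρ|y−y′|_T}` — the shifted bond lies in the same unit block or in its
neighbour (`tdistT_blockOf_sub_unitVec_le`), and `|y − e_κ − y′|_T ≥ |y − y′|_T − 1`. [cite: Balaban1984PropagatorsII, (2.52)–(2.55) pp.232–233 (block-majorant bookkeeping, shape)] -/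
theorem hasMaj_bshiftV_comp {b₁ : BlockNorm (unitTorusGeo L k M) F₁} {T : F₁ →ₗ[ℝ] (Tor (fine n M) × Fin (d + 1) → ℝ)} {B ρ : ℝ}
    (hB : 0 ≤ B) (hρ : 0 ≤ ρ) (κ : Fin (d + 1))
    (h : HasMaj b₁ (BlockNorm.ofBlocks (unitTorusGeo L k M) (fun i : Tor (fine n M) × Fin (d + 1) => blockOf n M i.1)) T
      (fun y y' => B * Real.exp (-(ρ * tdistT M y y')))) :
    HasMaj b₁ (BlockNorm.ofBlocks (unitTorusGeo L k M) (fun i : Tor (fine n M) × Fin (d + 1) => blockOf n M i.1)) (bshiftV M n κ ∘ₗ T)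
      (fun y y' => B * Real.exp ρ * Real.exp (-(ρ * tdistT M y y'))) := by
  refine hasMaj_pull_comp (g := unitTorusGeo L k M) (fun i : Tor (fine n M) × Fin (d + 1) => blockOf n M i.1)
    (fun i : Tor (fine n M) × Fin (d + 1) => (i.1 - unitVec (fine n M) κ, i.2))
    (fun _ _ => mul_nonneg (mul_nonneg hB (Real.exp_nonneg _)) (Real.exp_nonneg _)) (fun i y' => ?_) h
  show B * Real.exp (-(ρ * tdistT M (blockOf n M (i.1 - unitVec (fine n M) κ)) y')) ≤ B * Real.exp ρ * Real.exp (-(ρ * tdistT M (blockOf n M i.1) y'))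
  rw [mul_assoc, ← Real.exp_add]
  refine mul_le_mul_of_nonneg_left (Real.exp_le_exp.mpr ?_) hB
  have h1 := tdistT_triangle M (blockOf n M i.1) (blockOf n M (i.1 - unitVec (fine n M) κ)) y'
  have h2 : tdistT M (blockOf n M i.1) (blockOf n M (i.1 - unitVec (fine n M) κ)) ≤ 1 := by
    rw [tdistT_symm]; exact tdistT_blockOf_sub_unitVec_le n M i.1 κ
  nlinarith

variable (m : ℕ)

/-- **THE DEFECT OF THE TWO SHIFTS IS MAJORISED BY THE ONE-STEP DIFFERENCE.**  Through King's bond pairing, `𝔇(S′_{−κ}, S_{−κ})∘T` (coarse level `L^k`, fine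
level `L^mL^k`, fine bonds blocked by the unit block of their base point) has every block majorant `K ≥ 0` that `(1 − S_{−κ})∘T` has: at a fine bond `(x′, a)`
the defect `g(prV(x′ − e′_κ, a)) − g(pr x′ − e_κ, a)` (`g = Tμ`) VANISHES on the lower `κ`-face of the block (`pr(x′ − e′_κ) = pr x′ − e_κ`) and equals the one-step
difference `g(pr x′, a) − g(pr x′ − e_κ, a)` inside it (`kingPr_sub_unitVec`). [cite: King1986, p.664 (pairing convention «x′ ∈ B^n(x)»: the mechanism)] -/
theorem hasMaj_idefShift_comp [NeZero L] {b₁ : BlockNorm (unitTorusGeo L k M) F₁} {T : F₁ →ₗ[ℝ] (Tor (fine (L ^ k) M) × Fin (d + 1) → ℝ)}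
    {K : (unitTorusGeo L k M).Site → (unitTorusGeo L k M).Site → ℝ} (hK : ∀ y y', 0 ≤ K y y') (κ : Fin (d + 1))
    (h : HasMaj b₁ (BlockNorm.ofBlocks (unitTorusGeo L k M) (blkFine L k M)) ((LinearMap.id - bshiftV M (L ^ k) κ) ∘ₗ T) K) :
    HasMaj b₁ (BlockNorm.ofBlocks (unitTorusGeo L k M) (blkFine L k M ∘ kingPrV L k m M))
      (idef (pull (kingPrV L k m M)) (pull (kingPrV L k m M)) (bshiftV M (L ^ m * L ^ k) κ) (bshiftV M (L ^ k) κ) ∘ₗ T) K := by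
  intro y' μ hμ y
  refine loc_ofBlocks_le _ _ (mul_nonneg (hK y y') (b₁.loc_nonneg y' μ)) fun i hi => ?_
  rw [LinearMap.comp_apply, idef_bshiftV_apply]
  rcases kingPrV_sub M L k m i κ with hc | hc
  · -- inside the block: the one-step difference at the paired bond
    rw [hc]
    have hval : T μ (kingPrV L k m M i) - T μ ((kingPrV L k m M i).1 - unitVec (fine (L ^ k) M) κ, (kingPrV L k m M i).2) =
        (((LinearMap.id - bshiftV M (L ^ k) κ) ∘ₗ T : F₁ →ₗ[ℝ] (Tor (fine (L ^ k) M) × Fin (d + 1) → ℝ)) μ) (kingPrV L k m M i) := rfl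
    rw [hval]
    have hi' : blkFine L k M (kingPrV L k m M i) = y := hi
    exact (abs_le_loc_ofBlocks (g := unitTorusGeo L k M) (blkFine L k M) _ hi').trans (h y' μ hμ y)
  · -- on the lower face: the two shifts are paired, the defect vanishes
    rw [hc, sub_self, abs_zero]
    exact mul_nonneg (hK y y') (b₁.loc_nonneg y' μ)

end Transfer

/-! ## §4 Data: the backward pieces and the realised `V′₁` instance family at the vector piece ⊗ 1_𝔤 -/

section Pieces

variable (L : ℕ) (M : Fin (d + 1) → ℕ) [∀ μ, NeZero (M μ)] (n kk : ℕ) [NeZero n] (w : ℝ)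

/-- THE BACKWARD DERIVED PIECE `∇⁻_νG = S_{−ν}(∂_νG)` of the level-`n` vector single-scale piece (the backward difference quotient is the forward one read one step
back). [cite: Balaban1985BackgroundPropagators, (3.52) p.400 (the backward bond terms of `V′₁`, shape); Balaban1984PropagatorsI, (1.21) p.21] -/
def pieceD1b (ν : Fin (d + 1)) : (Tor (fine n M) × Fin (d + 1) → ℝ) →ₗ[ℝ] (Tor (fine n M) × Fin (d + 1) → ℝ) :=
  bshiftV M n ν ∘ₗ pieceD1 L M n kk w ν

/-- THE BACKWARD MIXED PIECE `∇⁻_μG∇_ν* = S_{−μ}(∂_μG∂_ν*)` ((3.44)-shaped source of the backward derived block). [cite: Balaban1985BackgroundPropagators, (3.44) p.398 (the mixed entry, shape); (3.52) p.400] -/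
def pieceMb (μ ν : Fin (d + 1)) : (Tor (fine n M) × Fin (d + 1) → ℝ) →ₗ[ℝ] (Tor (fine n M) × Fin (d + 1) → ℝ) :=
  bshiftV M n μ ∘ₗ pieceM L M n kk w μ ν

/-- THE DERIVED PIECES ON THE FORWARD∕BACKWARD STACK `J ⊕ J`: `inl μ ↦ ∂_μG`, `inr μ ↦ ∇⁻_μG`. [cite: Balaban1985BackgroundPropagators, (3.52) p.400 (both bond orientations, shape)] -/
def dPieces : Fin (d + 1) ⊕ Fin (d + 1) → (Tor (fine n M) × Fin (d + 1) → ℝ) →ₗ[ℝ] (Tor (fine n M) × Fin (d + 1) → ℝ) :=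
  Sum.elim (fun μ => pieceD1 L M n kk w μ) (fun μ => pieceD1b L M n kk w μ)

/-- THE MIXED PIECES ON THE STACK (source direction `ν`): `inl μ ↦ ∂_μG∂_ν*`, `inr μ ↦ ∇⁻_μG∂_ν*`. [cite: Balaban1985BackgroundPropagators, (3.44) p.398, (3.52) p.400 (shapes)] -/
def mPieces (ν : Fin (d + 1)) : Fin (d + 1) ⊕ Fin (d + 1) → (Tor (fine n M) × Fin (d + 1) → ℝ) →ₗ[ℝ] (Tor (fine n M) × Fin (d + 1) → ℝ) :=
  Sum.elim (fun μ => pieceM L M n kk w μ ν) (fun μ => pieceMb L M n kk w μ ν)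

/-- Forward component. [folklore] -/
@[simp] theorem dPieces_inl (μ : Fin (d + 1)) : dPieces L M n kk w (Sum.inl μ) = pieceD1 L M n kk w μ := rfl

/-- Backward component. [folklore] -/
@[simp] theorem dPieces_inr (μ : Fin (d + 1)) : dPieces L M n kk w (Sum.inr μ) = pieceD1b L M n kk w μ := rfl

/-- Forward component. [folklore] -/
@[simp] theorem mPieces_inl (ν μ : Fin (d + 1)) : mPieces L M n kk w ν (Sum.inl μ) = pieceM L M n kk w μ ν := rfl

/-- Backward component. [folklore] -/
@[simp] theorem mPieces_inr (ν μ : Fin (d + 1)) : mPieces L M n kk w ν (Sum.inr μ) = pieceMb L M n kk w μ ν := rfl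

end Pieces

section V1Family

variable (𝔄 : Type) [NormedRing 𝔄] [NormedAlgebra ℝ 𝔄] [CompleteSpace 𝔄] (ι : Type) [Fintype ι] [DecidableEq ι] (e : 𝔄 ≃L[ℝ] (ι → ℝ)) (L : ℕ) [NeZero L]

/-- THE REALISED `V′₁` INSTANCE at a sized index: V1b's `v1Instance` (configurations `U′ = (A⁺, A⁻, W)` — forward bond field, backward bond field, covariant
divergence, `𝔄`-valued; `Reg335` = the (3.35) letter pair on each in the norm of `𝔄`; transport = fibrewise means) over the SIZED unit-torus carrier on the
product carrier `X × ι`, blocks `liftBlk blkFine ι`, King's pairing, scale shift `m`, rate number `θ_j`. [cite: Balaban1985BackgroundPropagators, Thm 3.14 pp.426–427 (typing template); (3.35) p.396; (3.52) p.400 (the three coefficient fields, shape)] -/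
def v1VecInstance (hL : 1 ≤ L) (j : VecIndexS d L) : PairedInstance :=
  v1Instance 𝔄 (Fin (d + 1)) ι (g := unitTorusGeoS L j.k j.Mn j.Msz) (blkFine L j.k j.Mn) (kingPrV L j.k j.m j.Mn) j.m (unitTorusGeoS_L_ne_zero L hL j)
    (thetaV L j) (thetaV L j)

/-- THE REALISED `V′₁` KERNEL FAMILY: V2's `v1Family4` (the print's OWN `V′₁(A) = M_c + Σ_μ[M_{a⁺_μ}∇⁺_μ + M_{a⁻_μ}∇⁻_μ]` in coordinates `e`, DIAGONAL on the
forward∕backward stack, all four (3.42) entries CONSTRUCTED over M1's pair) fed with the -a pieces of the vector single-scale piece TENSORED WITH `1_𝔤`: `G`,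
`G∂_ν*`, `(Δ−∂∂*)G`, the derived pieces `dPieces` (`∂_μG` AND `∇⁻_μG`) and mixed pieces `mPieces` at both spacings; entry-1 direction `ν_j = inl j.ν` (the forward
`∇G(U)` block of the print). [cite: Balaban1985BackgroundPropagators, (3.42) p.397, (3.44) p.398, (3.52) p.400, (3.63)–(3.65) pp.402–403 (shapes, mechanism)] -/
def v1VecFamily4 (hL : 1 ≤ L) (j : VecIndexS d L) :
    B9.KernelFamily (v1VecInstance (d := d) 𝔄 ι L hL j).gc (v1VecInstance (d := d) 𝔄 ι L hL j).Bf :=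
  v1Family4 e (g := unitTorusGeoS L j.k j.Mn j.Msz) (blkFine L j.k j.Mn) (kingPrV L j.k j.m j.Mn) j.m (unitTorusGeoS_L_ne_zero L hL j) (thetaV L j)
    (thetaV L j) (Sum.inl j.ν)
    (tensorId ι (pieceG L j.Mn (L ^ j.k) j.k (rweight (d := d) L j.k))) (tensorId ι (pieceS L j.Mn (L ^ j.k) j.k (rweight (d := d) L j.k) j.ν))
    (tensorId ι (pieceD3 L j.Mn (L ^ j.k) j.k (rweight (d := d) L j.k)))
    (fun μ => tensorId ι (dPieces L j.Mn (L ^ j.k) j.k (rweight (d := d) L j.k) μ))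
    (fun μ => tensorId ι (mPieces L j.Mn (L ^ j.k) j.k (rweight (d := d) L j.k) j.ν μ))
    (tensorId ι (pieceG L j.Mn (L ^ j.m * L ^ j.k) (j.k + j.m) (rweight (d := d) L j.k / ((L : ℝ) ^ j.m) ^ (d + 1))))
    (tensorId ι (pieceS L j.Mn (L ^ j.m * L ^ j.k) (j.k + j.m) (rweight (d := d) L j.k / ((L : ℝ) ^ j.m) ^ (d + 1)) j.ν))
    (tensorId ι (pieceD3 L j.Mn (L ^ j.m * L ^ j.k) (j.k + j.m) (rweight (d := d) L j.k / ((L : ℝ) ^ j.m) ^ (d + 1))))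
    (fun μ => tensorId ι (dPieces L j.Mn (L ^ j.m * L ^ j.k) (j.k + j.m) (rweight (d := d) L j.k / ((L : ℝ) ^ j.m) ^ (d + 1)) μ))
    (fun μ => tensorId ι (mPieces L j.Mn (L ^ j.m * L ^ j.k) (j.k + j.m) (rweight (d := d) L j.k / ((L : ℝ) ^ j.m) ^ (d + 1)) j.ν μ))

omit [DecidableEq ι] [CompleteSpace 𝔄] in
/-- **THE GUARD IS LIVE**: the fine realised `V′₁` instance's [B9] size parameter IS the index's `M`. [folklore] -/
theorem v1VecInstance_gf_M (hL : 1 ≤ L) (j : VecIndexS d L) : (v1VecInstance (d := d) 𝔄 ι L hL j).gf.M = j.Msz := rfl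

omit [DecidableEq ι] [CompleteSpace 𝔄] in
/-- WHAT (3.35) SAYS HERE: `U′ = (A⁺, A⁻, W)` is `Reg335 c₃₅ α₀`-regular iff each of the three fields is `≤ c₃₅·M·α₀` pointwise in the norm of `𝔄` and has fibrewise
oscillation `≤ c₃₅·M·α₀·θ_j` over every King fibre — «|A| < O(1)Mα₀(L^jη)^{−1}, |∇^ηA| < O(1)Mα₀(L^jη)^{−2} on □» read blockwise, with the index's OWN `M`.
[cite: Balaban1985BackgroundPropagators, (3.35) p.396, (3.52) p.400] -/
theorem reg335_v1Vec_iff (hL : 1 ≤ L) (j : VecIndexS d L) (c35 α₀ : ℝ)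
    (U : (Fin (d + 1) → Tor (fine (L ^ j.m * L ^ j.k) j.Mn) × Fin (d + 1) → 𝔄) × (Fin (d + 1) → Tor (fine (L ^ j.m * L ^ j.k) j.Mn) × Fin (d + 1) → 𝔄) ×
      (Tor (fine (L ^ j.m * L ^ j.k) j.Mn) × Fin (d + 1) → 𝔄)) :
    (v1VecInstance (d := d) 𝔄 ι L hL j).Bf.Reg335 c35 α₀ U ↔
      ((∀ μ x', ‖U.1 μ x'‖ ≤ c35 * j.Msz * α₀) ∧ (∀ μ x', ‖U.2.1 μ x'‖ ≤ c35 * j.Msz * α₀) ∧ ∀ x', ‖U.2.2 x'‖ ≤ c35 * j.Msz * α₀) ∧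
        ((∀ μ x₁' x₂', kingPrV L j.k j.m j.Mn x₁' = kingPrV L j.k j.m j.Mn x₂' → ‖U.1 μ x₁' - U.1 μ x₂'‖ ≤ c35 * j.Msz * α₀ * thetaV L j) ∧
          (∀ μ x₁' x₂', kingPrV L j.k j.m j.Mn x₁' = kingPrV L j.k j.m j.Mn x₂' → ‖U.2.1 μ x₁' - U.2.1 μ x₂'‖ ≤ c35 * j.Msz * α₀ * thetaV L j) ∧
            ∀ x₁' x₂', kingPrV L j.k j.m j.Mn x₁' = kingPrV L j.k j.m j.Mn x₂' → ‖U.2.2 x₁' - U.2.2 x₂'‖ ≤ c35 * j.Msz * α₀ * thetaV L j) :=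
  Iff.rfl

end V1Family

end Summit.QuantumFields.YangMills.BalabanUVNodes.N15.VectorPiece

end
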